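import Literature.NumberTheory.NumberFields.RayClassFieldGaloisGroup
import HarnessLib

/-!
# THE ORDER `f` OF THE FROBENIUS OF `v` ON `K(𝔪)` AND A GENERATOR `α ≡ 1 mod 𝔪` OF `𝔭_v^f` — the global element `α` of the
# two-variable (c)-capstone tower EXISTS for every modulus (Artin reciprocity `Gal(K(𝔪)/K) ≅ Cl_K^𝔪`)

The (c)-capstone of the brick-(c) chain with the tower data supplied from ONE global element (`RayClassFieldTwoVariableTowerData[Offset]`,
`…ColemanCoinvariantCharTraceEllipticUnitsTowerData[Offset]`) asks for an `α ∈ 𝓞_K`, `α ≠ 0`, `α ≡ 1 mod 𝔤₀`, `(α) = 𝔭_v^f`, `α` a unit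
off `v`, with `f ∣ ord Frob_v(K(𝔤₀)/K)`.  THIS file proves that such an `α` EXISTS with `f = ord Frob_v(K(𝔤₀)/K)` EXACTLY, for every non-zero
modulus `𝔪` prime to `v` of a totally complex `K`: under Artin reciprocity `Gal(K(𝔪)/K) ≅ Cl_K^𝔪 = J^𝔪/P^𝔪`
(`RayClassFieldGaloisGroup.rayClassField_galEquivRayClassGroup`, `Frob_v ↦ [𝔭_v]`) the relation `[𝔭_v]^f = 1` says `𝔭_v^f = (a)` with
`a ≡ 1 mod* 𝔪` (`rayElements`), and `a` is integral because `(a)` is.  Everything PROVED (0 sorry, no definitions):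

* `orderOf_galFrob_rayClassField_eq_orderOf_primeClass` (`ord Frob_v = ord [𝔭_v]`);
* ★★ **`exists_generator_pow_orderOf_galFrob`** — `∃ α ≠ 0`, `α − 1 ∈ 𝔪`, `(α) = 𝔭_v^{ord Frob_v(K(𝔪))}`, `α ∉ w` for `w ≠ v`.

Cell `bsd-print-cf2`, width seat `bsd-line-cf2c-w7` g17 (discharges the binders `hα0 / hα𝔤 / hαw / hαf / hfo` of S51 generically).

## References
* [NeukirchANT1999] J. Neukirch, *Algebraic Number Theory* (1999), Ch. VI §1 Prop. (1.9), §6 Def. (6.2), §7 Thm. (7.1), Cor. (7.3).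
* [deShalit1987] E. de Shalit, *Iwasawa theory of elliptic curves with complex multiplication* (1987), II.1.10 (p. 39), II.4.14 (p. 71).
-/

noncomputable section

open NumberField IsDedekindDomain IsDedekindDomain.HeightOneSpectrum Field WithZero
open scoped nonZeroDivisors Classical

namespace Literature.NumberTheory.NumberFields

open Literature.NumberTheory.GaloisRepresentations Literature.NumberTheory.Automorphic

variable {K : Type} [Field K] [NumberField K] {𝔪 : Ideal (𝓞 K)} {v : HeightOneSpectrum (𝓞 K)}

variable [IsTotallyComplex K]

/-- **`ord Frob_v(K(𝔪)/K) = ord [𝔭_v]`** in `Cl_K^𝔪` (`v ∤ 𝔪`), under Artin reciprocity. [cite: NeukirchANT1999, Ch. VI §7 Cor. (7.3)] -/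
theorem orderOf_galFrob_rayClassField_eq_orderOf_primeClass (h𝔪 : 𝔪 ≠ ⊥) (hv : ¬ 𝔪 ≤ v.asIdeal) :
    orderOf (galFrob K (rayClassField K 𝔪) v) = orderOf (primeClass 𝔪 h𝔪 v) := by
  rw [← rayClassField_galEquivRayClassGroup_galFrob h𝔪 hv]
  exact (orderOf_injective (rayClassField_galEquivRayClassGroup h𝔪).toMonoidHom (rayClassField_galEquivRayClassGroup h𝔪).injective _).symm

/-- ★★ **A generator `α ≡ 1 mod 𝔪` of `𝔭_v^f`, `f = ord Frob_v(K(𝔪)/K)`**: for `𝔪 ≠ 0`, `v ∤ 𝔪`, there is `α ∈ 𝓞_K`, `α ≠ 0`, with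
`α − 1 ∈ 𝔪`, `(α) = 𝔭_v^{f}` and `α ∉ 𝔭_w` for every `w ≠ v` — `[𝔭_v]^f = 1` in `Cl_K^𝔪 = J^𝔪/P^𝔪` (Artin reciprocity), i.e. `𝔭_v^f = (a)` with
`a ≡ 1 mod* 𝔪`, and `a` is integral since `(a)` is. [cite: NeukirchANT1999, Ch. VI §1 Prop. (1.9), §7 Thm. (7.1)] [cite: deShalit1987, II.1.10 (p. 39)] -/
theorem exists_generator_pow_orderOf_galFrob (h𝔪 : 𝔪 ≠ ⊥) (hv : ¬ 𝔪 ≤ v.asIdeal) :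
    ∃ α : 𝓞 K, α ≠ 0 ∧ α - 1 ∈ 𝔪 ∧ Ideal.span {α} = v.asIdeal ^ orderOf (galFrob K (rayClassField K 𝔪) v) ∧
      ∀ w : HeightOneSpectrum (𝓞 K), w ≠ v → α ∉ w.asIdeal := by
  set f := orderOf (galFrob K (rayClassField K 𝔪) v) with hf
  -- `[𝔭_v]^f = 1` in `Cl_K^𝔪`
  have h1 : primeClass 𝔪 h𝔪 v ^ f = 1 := by
    rw [hf, orderOf_galFrob_rayClassField_eq_orderOf_primeClass h𝔪 hv]
    exact pow_orderOf_eq_one _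
  rw [primeClass_eq, ← QuotientGroup.mk_pow, QuotientGroup.eq_one_iff, Subgroup.mem_subgroupOf] at h1
  obtain ⟨a, ha, hab⟩ := mem_ray_iff.mp h1
  -- the fractional ideal `(a)` is `𝔭_v^f`
  have hfrac : (toPrincipalIdeal (𝓞 K) K a : FractionalIdeal (𝓞 K)⁰ K) = ((v.asIdeal ^ f : Ideal (𝓞 K)) : FractionalIdeal (𝓞 K)⁰ K) := by
    rw [hab, Subgroup.coe_pow, Units.val_pow_eq_pow_val, coe_unitOfPrime_of_not_le h𝔪 hv, FractionalIdeal.coeIdeal_pow]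
  -- `a` is integral
  have ha1 : (a : K) ∈ (1 : FractionalIdeal (𝓞 K)⁰ K) := by
    have hmem : (a : K) ∈ (toPrincipalIdeal (𝓞 K) K a : FractionalIdeal (𝓞 K)⁰ K) := by
      rw [coe_toPrincipalIdeal]
      exact FractionalIdeal.mem_spanSingleton_self _ _
    rw [hfrac] at hmem
    exact FractionalIdeal.coeIdeal_le_one hmem
  obtain ⟨α, hα⟩ := (FractionalIdeal.mem_one_iff _).mp ha1
  -- `(α) = 𝔭_v^f`
  have hspan : Ideal.span {α} = v.asIdeal ^ f := by
    rw [← FractionalIdeal.coeIdeal_inj (K := K), FractionalIdeal.coeIdeal_span_singleton, hα, ← coe_toPrincipalIdeal, hfrac]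
  have hα0 : α ≠ 0 := by
    intro h
    apply a.ne_zero
    rw [← hα, h, map_zero]
  refine ⟨α, hα0, ?_, hspan, fun w hw hαw ↦ ?_⟩
  · -- `α − 1 ∈ 𝔪` from `a ≡ 1 mod* 𝔪`
    refine mem_of_forall_mem_pow_modulusExp h𝔪 fun w hw ↦ ?_
    rw [← intValuation_le_pow_iff_mem, ← valuation_of_algebraMap (K := K)]
    have e : algebraMap (𝓞 K) K (α - 1) = (a : K) - 1 := by rw [map_sub, map_one, hα]
    change w.valuation K (algebraMap (𝓞 K) K (α - 1)) ≤ _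
    rw [e]
    exact ha.1 w hw
  · -- `α ∉ 𝔭_w` for `w ≠ v`: `𝔭_w ∣ (α) = 𝔭_v^f` forces `w = v`
    have hdvd : w.asIdeal ∣ v.asIdeal ^ f := by
      rw [← hspan, Ideal.dvd_span_singleton]
      exact hαw
    have hwv : w.asIdeal ∣ v.asIdeal := (w.prime.dvd_of_dvd_pow hdvd)
    exact hw (HeightOneSpectrum.ext ((v.isMaximal.eq_of_le w.isPrime.ne_top (Ideal.le_of_dvd hwv)).symm))

end Literature.NumberTheory.NumberFields

end
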